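import Summits.SmoothPoincare4.SmoothPoincare4.Theses.EuclideanOrigami

/-!
# Crease ladder — the seam BY NAME, the GlueBy rehearsal, positioning and logical shape
# (crux `CreaseCollapse`, stmt-SmoothPoincare4-7481, route SmoothPoincare4/EuclideanOrigami)

Companion of `Cruxes/CreaseCollapse/Split.lean` (frame form, no route import). This file DOES import the
route module and kernel-checks, against the route decl `EuclideanOrigami.CreaseCollapse` (rev 4):

1. `creaseCollapse_of_pieces_frame` — verbatim copy of the frame-form assembly (35 tactic lines);
2. `GlueByRehearsal.CreaseCollapseGlueBy_holds : TameCrease → QuadrupleCancellation →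
   TripleCircleElimination → CreaseCollapse := creaseCollapse_of_pieces_frame` — exactly the link the gate
   renders on `route edit --split CreaseCollapse --glue-by …creaseCollapse_of_pieces`, with the three
   children re-declared from their children.json bodies: it typechecks by δ-unfolding (term mode, no tactic);
   the same term closes a generated glue ITEM `CreaseLadderGlue` (`--glue` variant) after `unfold`;
3. POSITIONING (honesty): each piece is a CONSEQUENCE of the crux —
   `tameCrease_of_creaseCollapse`, `quadrupleCancellation_of_creaseCollapse`,
   `tripleCircleElimination_of_creaseCollapse` (a triple-point-free crease has `T = ∅ ⊇ Q`, and answers every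
   instance of the two step pieces with strictly fewer defects) — so no piece is STRONGER than the crux, and
   the conjunction of the three is EQUIVALENT to it (`creaseCollapse_iff_pieces`);
4. LOGICAL SHAPE (stated as theorems, not hidden): with the rung predicates
   `RungFour S e` (a tame immersed fake ball exists), `RungThree S e` (a tame quadruple-free one exists),
   `RungTwo S e` (a triple-point-free one exists; `rungTwo_iff` : ↔ the crux's clause at `(S, e)`):
   `tameCrease_iff : TameCrease ↔ ∀ S e, emb e → RungFour S e`,
   `quadrupleCancellation_iff : QuadrupleCancellation ↔ ∀ S e, emb e → RungFour S e → RungThree S e`,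
   `tripleCircleElimination_iff : TripleCircleElimination ↔ ∀ S e, emb e → RungThree S e → RungTwo S e`.
   So the decomposition is the bridge chain `C₄`, `C₄ → C₃`, `C₃ → C₂` through the intermediate rung `C₃`
   ("some immersed fake ball has a tame quadruple-free crease"), an object neither the summit nor the crux
   mentions; the one-defect-at-a-time signatures filed as items are the form the skeletons attack, and the
   assembly is the well-founded descent along `(#Q, #π₀T)`.

No `sorry`; axioms `propext`, `Classical.choice`, `Quot.sound` only.
-/

set_option linter.dupNamespace false

namespace Summit.SmoothPoincare4.SmoothPoincare4.Cruxes.CreaseCollapse.LadderSeam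

open scoped Manifold ContDiff Topology
open Set Function
open Summit.SmoothPoincare4.SmoothPoincare4.Theses.EuclideanOrigami

/-! ## The named functionals of an immersed fake ball -/

section Functionals

variable {S : Literature.Topology.FourManifolds.HomotopySphere 4}

/-- The immersion clause: `F` is a local diffeomorphism at every point off `e(B̊⁴)`, i.e. on `Δ_e`. -/
def IsImmersedFakeBall (e : EuclideanSpace ℝ (Fin 4) → S.carrier) (F : S.carrier → EuclideanSpace ℝ (Fin 4)) :
    Prop :=
  ∀ x, x ∉ e '' Metric.ball (0 : EuclideanSpace ℝ (Fin 4)) 1 → IsLocalDiffeomorphAt (𝓡 4) (𝓡 4) ∞ F x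

/-- The quadruple-value set of the crease `F ∘ e|S³`. -/
def quadValues (e : EuclideanSpace ℝ (Fin 4) → S.carrier) (F : S.carrier → EuclideanSpace ℝ (Fin 4)) :
    Set (EuclideanSpace ℝ (Fin 4)) :=
  {y : EuclideanSpace ℝ (Fin 4) | ∃ a b c d : EuclideanSpace ℝ (Fin 4), ‖a‖ = 1 ∧ ‖b‖ = 1 ∧ ‖c‖ = 1 ∧
    ‖d‖ = 1 ∧ a ≠ b ∧ a ≠ c ∧ a ≠ d ∧ b ≠ c ∧ b ≠ d ∧ c ≠ d ∧ F (e a) = y ∧ F (e b) = y ∧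
    F (e c) = y ∧ F (e d) = y}

/-- The triple-value set of the crease `F ∘ e|S³`. -/
def tripleValues (e : EuclideanSpace ℝ (Fin 4) → S.carrier) (F : S.carrier → EuclideanSpace ℝ (Fin 4)) :
    Set (EuclideanSpace ℝ (Fin 4)) :=
  {y : EuclideanSpace ℝ (Fin 4) | ∃ u v w : EuclideanSpace ℝ (Fin 4), ‖u‖ = 1 ∧ ‖v‖ = 1 ∧ ‖w‖ = 1 ∧
    u ≠ v ∧ v ≠ w ∧ u ≠ w ∧ F (e u) = y ∧ F (e v) = y ∧ F (e w) = y}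

/-- The set of connected components of a subset of `ℝ⁴`. -/
def components (T : Set (EuclideanSpace ℝ (Fin 4))) : Set (Set (EuclideanSpace ℝ (Fin 4))) :=
  (fun y => connectedComponentIn T y) '' T

/-- The "no triple points" clause of the crux, for one immersed fake ball. -/
def NoTriplePoints (e : EuclideanSpace ℝ (Fin 4) → S.carrier) (F : S.carrier → EuclideanSpace ℝ (Fin 4)) :
    Prop :=
  ∀ u v w : EuclideanSpace ℝ (Fin 4), ‖u‖ = 1 → ‖v‖ = 1 → ‖w‖ = 1 → F (e u) = F (e v) → F (e v) = F (e w) →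
    u = v ∨ v = w ∨ u = w

/-- A quadruple value is a triple value. -/
theorem quadValues_subset_tripleValues (e : EuclideanSpace ℝ (Fin 4) → S.carrier)
    (F : S.carrier → EuclideanSpace ℝ (Fin 4)) : quadValues e F ⊆ tripleValues e F := by
  rintro y ⟨a, b, c, d, ha, hb, hc, -, hab, hac, -, hbc, -, -, hFa, hFb, hFc, -⟩
  exact ⟨a, b, c, ha, hb, hc, hab, hbc, hac, hFa, hFb, hFc⟩

/-- The crux's clause at `(S, e, F)` says exactly that the triple-value set is empty. -/
theorem noTriplePoints_iff_tripleValues_eq_empty (e : EuclideanSpace ℝ (Fin 4) → S.carrier)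
    (F : S.carrier → EuclideanSpace ℝ (Fin 4)) : NoTriplePoints e F ↔ tripleValues e F = ∅ := by
  constructor
  · intro h
    ext y
    simp only [tripleValues, mem_setOf_eq, mem_empty_iff_false, iff_false]
    rintro ⟨u, v, w, hu, hv, hw, huv, hvw, huw, hFu, hFv, hFw⟩
    rcases h u v w hu hv hw (hFu.trans hFv.symm) (hFv.trans hFw.symm) with h' | h' | h'
    exacts [huv h', hvw h', huw h']
  · intro h u v w hu hv hw h₁ h₂
    by_contra hne
    push Not at hne
    have hmem : F (e u) ∈ tripleValues e F :=
      ⟨u, v, w, hu, hv, hw, hne.1, hne.2.1, hne.2.2, rfl, h₁.symm, (h₁.trans h₂).symm⟩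
    rw [h] at hmem
    exact hmem

/-- The three rungs of the crease ladder at a fixed `(S, e)`: RUNG 4 = some immersed fake ball has a TAME
crease (finitely many quadruple values, finitely many triple-value components). -/
def RungFour (S : Literature.Topology.FourManifolds.HomotopySphere 4)
    (e : EuclideanSpace ℝ (Fin 4) → S.carrier) : Prop :=
  ∃ F : S.carrier → EuclideanSpace ℝ (Fin 4), IsImmersedFakeBall e F ∧ (quadValues e F).Finite ∧
    (components (tripleValues e F)).Finite

/-- RUNG 3 = some immersed fake ball has a tame QUADRUPLE-FREE crease. -/
def RungThree (S : Literature.Topology.FourManifolds.HomotopySphere 4)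
    (e : EuclideanSpace ℝ (Fin 4) → S.carrier) : Prop :=
  ∃ F : S.carrier → EuclideanSpace ℝ (Fin 4), IsImmersedFakeBall e F ∧ quadValues e F = ∅ ∧
    (components (tripleValues e F)).Finite

/-- RUNG 2 = some immersed fake ball has a TRIPLE-POINT-FREE crease (the crux at `(S, e)`). -/
def RungTwo (S : Literature.Topology.FourManifolds.HomotopySphere 4)
    (e : EuclideanSpace ℝ (Fin 4) → S.carrier) : Prop :=
  ∃ F : S.carrier → EuclideanSpace ℝ (Fin 4), IsImmersedFakeBall e F ∧ tripleValues e F = ∅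

theorem rungTwo_iff (S : Literature.Topology.FourManifolds.HomotopySphere 4)
    (e : EuclideanSpace ℝ (Fin 4) → S.carrier) :
    RungTwo S e ↔ ∃ F : S.carrier → EuclideanSpace ℝ (Fin 4), IsImmersedFakeBall e F ∧ NoTriplePoints e F := by
  simp only [RungTwo, noTriplePoints_iff_tripleValues_eq_empty]

end Functionals

/-! ## The children, re-declared verbatim from children.json (as the gate will render them) -/

/-- children.json child 1 (support): tame immersed fake balls exist. -/
def TameCrease : Prop :=
  ∀ (S : Literature.Topology.FourManifolds.HomotopySphere 4) (e : EuclideanSpace ℝ (Fin 4) → S.carrier), Manifold.IsSmoothEmbedding (𝓡 4) (𝓡 4) ∞ e → ∃ F : S.carrier → EuclideanSpace ℝ (Fin 4), (∀ x, x ∉ e '' Metric.ball (0 : EuclideanSpace ℝ (Fin 4)) 1 → IsLocalDiffeomorphAt (𝓡 4) (𝓡 4) ∞ F x) ∧ {y : EuclideanSpace ℝ (Fin 4) | ∃ a b c d : EuclideanSpace ℝ (Fin 4), ‖a‖ = 1 ∧ ‖b‖ = 1 ∧ ‖c‖ = 1 ∧ ‖d‖ = 1 ∧ a ≠ b ∧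 a ≠ c ∧ a ≠ d ∧ b ≠ c ∧ b ≠ d ∧ c ≠ d ∧ F (e a) = y ∧ F (e b) = y ∧ F (e c) = y ∧ F (e d) = y}.Finite ∧ ((fun y => connectedComponentIn {y : EuclideanSpace ℝ (Fin 4) | ∃ u v w : EuclideanSpace ℝ (Fin 4), ‖u‖ = 1 ∧ ‖v‖ = 1 ∧ ‖w‖ = 1 ∧ u ≠ v ∧ v ≠ w ∧ u ≠ w ∧ F (e u) = y ∧ F (e v) = y ∧ F (e w) = y} y) '' {y : EuclideanSpace ℝ (Fin 4) | ∃ u v w : EuclideanSpace ℝ (Fin 4), ‖u‖ = 1 ∧ ‖v‖ = 1 ∧ ‖w‖ = 1 ∧ u ≠ v ∧ v ≠ w ∧ u ≠ w ∧ F (e u) = y ∧ F (e v) = y ∧ F (e w) = y}).Finite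

/-- children.json child 2 (crux, rung 4 → 3): quadruple-value cancellation. -/
def QuadrupleCancellation : Prop :=
  ∀ (S : Literature.Topology.FourManifolds.HomotopySphere 4) (e : EuclideanSpace ℝ (Fin 4) → S.carrier) (F : S.carrier → EuclideanSpace ℝ (Fin 4)), Manifold.IsSmoothEmbedding (𝓡 4) (𝓡 4) ∞ e → (∀ x, x ∉ e '' Metric.ball (0 : EuclideanSpace ℝ (Fin 4)) 1 → IsLocalDiffeomorphAt (𝓡 4) (𝓡 4) ∞ F x) → {y : EuclideanSpace ℝ (Fin 4) | ∃ a b c d : EuclideanSpace ℝ (Fin 4), ‖a‖ = 1 ∧ ‖b‖ = 1 ∧ ‖c‖ = 1 ∧ ‖d‖ = 1 ∧ a ≠ b ∧ a ≠ c ∧ a ≠ d ∧ b ≠ c ∧ b ≠ d ∧ c ≠ d ∧ F (e a) = y ∧ F (e b) = y ∧ F (e c) = y ∧ F (e d) = y}.Finite → {y : EuclideanSpace ℝ (Fin 4) | ∃ a b c d : EuclideanSpace ℝ (Fin 4), ‖a‖ = 1 ∧ ‖b‖ = 1 ∧ ‖c‖ = 1 ∧ ‖d‖ = 1 ∧ a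 ≠ b ∧ a ≠ c ∧ a ≠ d ∧ b ≠ c ∧ b ≠ d ∧ c ≠ d ∧ F (e a) = y ∧ F (e b) = y ∧ F (e c) = y ∧ F (e d) = y}.Nonempty → ((fun y => connectedComponentIn {y : EuclideanSpace ℝ (Fin 4) | ∃ u v w : EuclideanSpace ℝ (Fin 4), ‖u‖ = 1 ∧ ‖v‖ = 1 ∧ ‖w‖ = 1 ∧ u ≠ v ∧ v ≠ w ∧ u ≠ w ∧ F (e u) = y ∧ F (e v) = y ∧ F (e w) = y} y) '' {y : EuclideanSpace ℝ (Fin 4) | ∃ u v w : EuclideanSpace ℝ (Fin 4), ‖u‖ = 1 ∧ ‖v‖ = 1 ∧ ‖w‖ = 1 ∧ u ≠ v ∧ v ≠ w ∧ u ≠ w ∧ F (e u) = y ∧ F (e v) = y ∧ F (e w) = y}).Finite → ∃ F' : S.carrier → EuclideanSpace ℝ (Fin 4), (∀ x, x ∉ e '' Metric.ball (0 : EuclideanSpace ℝ (Fin 4)) 1 → IsLocalDiffeomorphAt (𝓡 4) (𝓡 4) ∞ F' x) ∧ {y : EuclideanSpace ℝ (Fin 4) | ∃ a b c d : EuclideanSpace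 ℝ (Fin 4), ‖a‖ = 1 ∧ ‖b‖ = 1 ∧ ‖c‖ = 1 ∧ ‖d‖ = 1 ∧ a ≠ b ∧ a ≠ c ∧ a ≠ d ∧ b ≠ c ∧ b ≠ d ∧ c ≠ d ∧ F' (e a) = y ∧ F' (e b) = y ∧ F' (e c) = y ∧ F' (e d) = y}.Finite ∧ {y : EuclideanSpace ℝ (Fin 4) | ∃ a b c d : EuclideanSpace ℝ (Fin 4), ‖a‖ = 1 ∧ ‖b‖ = 1 ∧ ‖c‖ = 1 ∧ ‖d‖ = 1 ∧ a ≠ b ∧ a ≠ c ∧ a ≠ d ∧ b ≠ c ∧ b ≠ d ∧ c ≠ d ∧ F' (e a) = y ∧ F' (e b) = y ∧ F' (e c) = y ∧ F' (e d) = y}.ncard < {y : EuclideanSpace ℝ (Fin 4) | ∃ a b c d : EuclideanSpace ℝ (Fin 4), ‖a‖ = 1 ∧ ‖b‖ = 1 ∧ ‖c‖ = 1 ∧ ‖d‖ = 1 ∧ a ≠ b ∧ a ≠ c ∧ a ≠ d ∧ b ≠ c ∧ b ≠ d ∧ c ≠ d ∧ F (e a) = y ∧ F (e b) = y ∧ F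 (e c) = y ∧ F (e d) = y}.ncard ∧ ((fun y => connectedComponentIn {y : EuclideanSpace ℝ (Fin 4) | ∃ u v w : EuclideanSpace ℝ (Fin 4), ‖u‖ = 1 ∧ ‖v‖ = 1 ∧ ‖w‖ = 1 ∧ u ≠ v ∧ v ≠ w ∧ u ≠ w ∧ F' (e u) = y ∧ F' (e v) = y ∧ F' (e w) = y} y) '' {y : EuclideanSpace ℝ (Fin 4) | ∃ u v w : EuclideanSpace ℝ (Fin 4), ‖u‖ = 1 ∧ ‖v‖ = 1 ∧ ‖w‖ = 1 ∧ u ≠ v ∧ v ≠ w ∧ u ≠ w ∧ F' (e u) = y ∧ F' (e v) = y ∧ F' (e w) = y}).Finite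

/-- children.json child 3 (crux, rung 3 → 2): triple-circle elimination. -/
def TripleCircleElimination : Prop :=
  ∀ (S : Literature.Topology.FourManifolds.HomotopySphere 4) (e : EuclideanSpace ℝ (Fin 4) → S.carrier) (F : S.carrier → EuclideanSpace ℝ (Fin 4)), Manifold.IsSmoothEmbedding (𝓡 4) (𝓡 4) ∞ e → (∀ x, x ∉ e '' Metric.ball (0 : EuclideanSpace ℝ (Fin 4)) 1 → IsLocalDiffeomorphAt (𝓡 4) (𝓡 4) ∞ F x) → {y : EuclideanSpace ℝ (Fin 4) | ∃ a b c d : EuclideanSpace ℝ (Fin 4), ‖a‖ = 1 ∧ ‖b‖ = 1 ∧ ‖c‖ = 1 ∧ ‖d‖ = 1 ∧ a ≠ b ∧ a ≠ c ∧ a ≠ d ∧ b ≠ c ∧ b ≠ d ∧ c ≠ d ∧ F (e a) = y ∧ F (e b) = y ∧ F (e c) = y ∧ F (e d) = y} = ∅ → ((fun y => connectedComponentIn {y : EuclideanSpace ℝ (Fin 4) | ∃ u v w : EuclideanSpace ℝ (Fin 4), ‖u‖ = 1 ∧ ‖v‖ = 1 ∧ ‖w‖ = 1 ∧ u ≠ v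 ∧ v ≠ w ∧ u ≠ w ∧ F (e u) = y ∧ F (e v) = y ∧ F (e w) = y} y) '' {y : EuclideanSpace ℝ (Fin 4) | ∃ u v w : EuclideanSpace ℝ (Fin 4), ‖u‖ = 1 ∧ ‖v‖ = 1 ∧ ‖w‖ = 1 ∧ u ≠ v ∧ v ≠ w ∧ u ≠ w ∧ F (e u) = y ∧ F (e v) = y ∧ F (e w) = y}).Finite → {y : EuclideanSpace ℝ (Fin 4) | ∃ u v w : EuclideanSpace ℝ (Fin 4), ‖u‖ = 1 ∧ ‖v‖ = 1 ∧ ‖w‖ = 1 ∧ u ≠ v ∧ v ≠ w ∧ u ≠ w ∧ F (e u) = y ∧ F (e v) = y ∧ F (e w) = y}.Nonempty → ∃ F' : S.carrier → EuclideanSpace ℝ (Fin 4), (∀ x, x ∉ e '' Metric.ball (0 : EuclideanSpace ℝ (Fin 4)) 1 → IsLocalDiffeomorphAt (𝓡 4) (𝓡 4) ∞ F' x) ∧ {y : EuclideanSpace ℝ (Fin 4) | ∃ a b c d : EuclideanSpace ℝ (Fin 4), ‖a‖ = 1 ∧ ‖b‖ = 1 ∧ ‖c‖ = 1 ∧ ‖d‖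 = 1 ∧ a ≠ b ∧ a ≠ c ∧ a ≠ d ∧ b ≠ c ∧ b ≠ d ∧ c ≠ d ∧ F' (e a) = y ∧ F' (e b) = y ∧ F' (e c) = y ∧ F' (e d) = y} = ∅ ∧ ((fun y => connectedComponentIn {y : EuclideanSpace ℝ (Fin 4) | ∃ u v w : EuclideanSpace ℝ (Fin 4), ‖u‖ = 1 ∧ ‖v‖ = 1 ∧ ‖w‖ = 1 ∧ u ≠ v ∧ v ≠ w ∧ u ≠ w ∧ F' (e u) = y ∧ F' (e v) = y ∧ F' (e w) = y} y) '' {y : EuclideanSpace ℝ (Fin 4) | ∃ u v w : EuclideanSpace ℝ (Fin 4), ‖u‖ = 1 ∧ ‖v‖ = 1 ∧ ‖w‖ = 1 ∧ u ≠ v ∧ v ≠ w ∧ u ≠ w ∧ F' (e u) = y ∧ F' (e v) = y ∧ F' (e w) = y}).Finite ∧ ((fun y => connectedComponentIn {y : EuclideanSpace ℝ (Fin 4) | ∃ u v w : EuclideanSpace ℝ (Fin 4), ‖u‖ = 1 ∧ ‖v‖ = 1 ∧ ‖w‖ = 1 ∧ u ≠ v ∧ v ≠ w ∧ u ≠ w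 ∧ F' (e u) = y ∧ F' (e v) = y ∧ F' (e w) = y} y) '' {y : EuclideanSpace ℝ (Fin 4) | ∃ u v w : EuclideanSpace ℝ (Fin 4), ‖u‖ = 1 ∧ ‖v‖ = 1 ∧ ‖w‖ = 1 ∧ u ≠ v ∧ v ≠ w ∧ u ≠ w ∧ F' (e u) = y ∧ F' (e v) = y ∧ F' (e w) = y}).ncard < ((fun y => connectedComponentIn {y : EuclideanSpace ℝ (Fin 4) | ∃ u v w : EuclideanSpace ℝ (Fin 4), ‖u‖ = 1 ∧ ‖v‖ = 1 ∧ ‖w‖ = 1 ∧ u ≠ v ∧ v ≠ w ∧ u ≠ w ∧ F (e u) = y ∧ F (e v) = y ∧ F (e w) = y} y) '' {y : EuclideanSpace ℝ (Fin 4) | ∃ u v w : EuclideanSpace ℝ (Fin 4), ‖u‖ = 1 ∧ ‖v‖ = 1 ∧ ‖w‖ = 1 ∧ u ≠ v ∧ v ≠ w ∧ u ≠ w ∧ F (e u) = y ∧ F (e v) = y ∧ F (e w) = y}).ncard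

/-! ## 1. The assembly, frame form (verbatim copy of `Split.lean`) -/

/-- **Crease ladder, frame form.** `⟦TameCrease⟧ → ⟦QuadrupleCancellation⟧ → ⟦TripleCircleElimination⟧ →
⟦CreaseCollapse⟧`, every body verbatim (children.json / route decl `EuclideanOrigami.CreaseCollapse`). -/
theorem creaseCollapse_of_pieces_frame :
    (∀ (S : Literature.Topology.FourManifolds.HomotopySphere 4) (e : EuclideanSpace ℝ (Fin 4) → S.carrier), Manifold.IsSmoothEmbedding (𝓡 4) (𝓡 4) ∞ e → ∃ F : S.carrier → EuclideanSpace ℝ (Fin 4), (∀ x, x ∉ e '' Metric.ball (0 : EuclideanSpace ℝ (Fin 4)) 1 → IsLocalDiffeomorphAt (𝓡 4) (𝓡 4) ∞ F x) ∧ {y : EuclideanSpace ℝ (Fin 4) | ∃ a b c d : EuclideanSpace ℝ (Fin 4), ‖a‖ = 1 ∧ ‖b‖ = 1 ∧ ‖c‖ = 1 ∧ ‖d‖ = 1 ∧ a ≠ b ∧ a ≠ c ∧ a ≠ d ∧ b ≠ c ∧ b ≠ d ∧ c ≠ d ∧ F (e a) = y ∧ F (e b) = y ∧ F (e c) = y ∧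 F (e d) = y}.Finite ∧ ((fun y => connectedComponentIn {y : EuclideanSpace ℝ (Fin 4) | ∃ u v w : EuclideanSpace ℝ (Fin 4), ‖u‖ = 1 ∧ ‖v‖ = 1 ∧ ‖w‖ = 1 ∧ u ≠ v ∧ v ≠ w ∧ u ≠ w ∧ F (e u) = y ∧ F (e v) = y ∧ F (e w) = y} y) '' {y : EuclideanSpace ℝ (Fin 4) | ∃ u v w : EuclideanSpace ℝ (Fin 4), ‖u‖ = 1 ∧ ‖v‖ = 1 ∧ ‖w‖ = 1 ∧ u ≠ v ∧ v ≠ w ∧ u ≠ w ∧ F (e u) = y ∧ F (e v) = y ∧ F (e w) = y}).Finite) →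
    (∀ (S : Literature.Topology.FourManifolds.HomotopySphere 4) (e : EuclideanSpace ℝ (Fin 4) → S.carrier) (F : S.carrier → EuclideanSpace ℝ (Fin 4)), Manifold.IsSmoothEmbedding (𝓡 4) (𝓡 4) ∞ e → (∀ x, x ∉ e '' Metric.ball (0 : EuclideanSpace ℝ (Fin 4)) 1 → IsLocalDiffeomorphAt (𝓡 4) (𝓡 4) ∞ F x) → {y : EuclideanSpace ℝ (Fin 4) | ∃ a b c d : EuclideanSpace ℝ (Fin 4), ‖a‖ = 1 ∧ ‖b‖ = 1 ∧ ‖c‖ = 1 ∧ ‖d‖ = 1 ∧ a ≠ b ∧ a ≠ c ∧ a ≠ d ∧ b ≠ c ∧ b ≠ d ∧ c ≠ d ∧ F (e a) = y ∧ F (e b) = y ∧ F (e c) = y ∧ F (e d) = y}.Finite → {y : EuclideanSpace ℝ (Fin 4) | ∃ a b c d : EuclideanSpace ℝ (Fin 4), ‖a‖ = 1 ∧ ‖b‖ = 1 ∧ ‖c‖ = 1 ∧ ‖d‖ = 1 ∧ a ≠ b ∧ a ≠ c ∧ a ≠ d ∧ b ≠ c ∧ b ≠ d ∧ c ≠ d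 ∧ F (e a) = y ∧ F (e b) = y ∧ F (e c) = y ∧ F (e d) = y}.Nonempty → ((fun y => connectedComponentIn {y : EuclideanSpace ℝ (Fin 4) | ∃ u v w : EuclideanSpace ℝ (Fin 4), ‖u‖ = 1 ∧ ‖v‖ = 1 ∧ ‖w‖ = 1 ∧ u ≠ v ∧ v ≠ w ∧ u ≠ w ∧ F (e u) = y ∧ F (e v) = y ∧ F (e w) = y} y) '' {y : EuclideanSpace ℝ (Fin 4) | ∃ u v w : EuclideanSpace ℝ (Fin 4), ‖u‖ = 1 ∧ ‖v‖ = 1 ∧ ‖w‖ = 1 ∧ u ≠ v ∧ v ≠ w ∧ u ≠ w ∧ F (e u) = y ∧ F (e v) = y ∧ F (e w) = y}).Finite → ∃ F' : S.carrier → EuclideanSpace ℝ (Fin 4), (∀ x, x ∉ e '' Metric.ball (0 : EuclideanSpace ℝ (Fin 4)) 1 → IsLocalDiffeomorphAt (𝓡 4) (𝓡 4) ∞ F' x) ∧ {y : EuclideanSpace ℝ (Fin 4) | ∃ a b c d : EuclideanSpace ℝ (Fin 4), ‖a‖ = 1 ∧ ‖b‖ = 1 ∧ ‖c‖ = 1 ∧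 ‖d‖ = 1 ∧ a ≠ b ∧ a ≠ c ∧ a ≠ d ∧ b ≠ c ∧ b ≠ d ∧ c ≠ d ∧ F' (e a) = y ∧ F' (e b) = y ∧ F' (e c) = y ∧ F' (e d) = y}.Finite ∧ {y : EuclideanSpace ℝ (Fin 4) | ∃ a b c d : EuclideanSpace ℝ (Fin 4), ‖a‖ = 1 ∧ ‖b‖ = 1 ∧ ‖c‖ = 1 ∧ ‖d‖ = 1 ∧ a ≠ b ∧ a ≠ c ∧ a ≠ d ∧ b ≠ c ∧ b ≠ d ∧ c ≠ d ∧ F' (e a) = y ∧ F' (e b) = y ∧ F' (e c) = y ∧ F' (e d) = y}.ncard < {y : EuclideanSpace ℝ (Fin 4) | ∃ a b c d : EuclideanSpace ℝ (Fin 4), ‖a‖ = 1 ∧ ‖b‖ = 1 ∧ ‖c‖ = 1 ∧ ‖d‖ = 1 ∧ a ≠ b ∧ a ≠ c ∧ a ≠ d ∧ b ≠ c ∧ b ≠ d ∧ c ≠ d ∧ F (e a) = y ∧ F (e b) = y ∧ F (e c) = y ∧ F (e d) = y}.ncard ∧ ((fun y => connectedComponentIn {y : EuclideanSpace ℝ (Fin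 4) | ∃ u v w : EuclideanSpace ℝ (Fin 4), ‖u‖ = 1 ∧ ‖v‖ = 1 ∧ ‖w‖ = 1 ∧ u ≠ v ∧ v ≠ w ∧ u ≠ w ∧ F' (e u) = y ∧ F' (e v) = y ∧ F' (e w) = y} y) '' {y : EuclideanSpace ℝ (Fin 4) | ∃ u v w : EuclideanSpace ℝ (Fin 4), ‖u‖ = 1 ∧ ‖v‖ = 1 ∧ ‖w‖ = 1 ∧ u ≠ v ∧ v ≠ w ∧ u ≠ w ∧ F' (e u) = y ∧ F' (e v) = y ∧ F' (e w) = y}).Finite) →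
    (∀ (S : Literature.Topology.FourManifolds.HomotopySphere 4) (e : EuclideanSpace ℝ (Fin 4) → S.carrier) (F : S.carrier → EuclideanSpace ℝ (Fin 4)), Manifold.IsSmoothEmbedding (𝓡 4) (𝓡 4) ∞ e → (∀ x, x ∉ e '' Metric.ball (0 : EuclideanSpace ℝ (Fin 4)) 1 → IsLocalDiffeomorphAt (𝓡 4) (𝓡 4) ∞ F x) → {y : EuclideanSpace ℝ (Fin 4) | ∃ a b c d : EuclideanSpace ℝ (Fin 4), ‖a‖ = 1 ∧ ‖b‖ = 1 ∧ ‖c‖ = 1 ∧ ‖d‖ = 1 ∧ a ≠ b ∧ a ≠ c ∧ a ≠ d ∧ b ≠ c ∧ b ≠ d ∧ c ≠ d ∧ F (e a) = y ∧ F (e b) = y ∧ F (e c) = y ∧ F (e d) = y} = ∅ → ((fun y => connectedComponentIn {y : EuclideanSpace ℝ (Fin 4) | ∃ u v w : EuclideanSpace ℝ (Fin 4), ‖u‖ = 1 ∧ ‖v‖ = 1 ∧ ‖w‖ = 1 ∧ u ≠ v ∧ v ≠ w ∧ u ≠ w ∧ F (e u) = y ∧ F (e v) = y ∧ F (e w)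 = y} y) '' {y : EuclideanSpace ℝ (Fin 4) | ∃ u v w : EuclideanSpace ℝ (Fin 4), ‖u‖ = 1 ∧ ‖v‖ = 1 ∧ ‖w‖ = 1 ∧ u ≠ v ∧ v ≠ w ∧ u ≠ w ∧ F (e u) = y ∧ F (e v) = y ∧ F (e w) = y}).Finite → {y : EuclideanSpace ℝ (Fin 4) | ∃ u v w : EuclideanSpace ℝ (Fin 4), ‖u‖ = 1 ∧ ‖v‖ = 1 ∧ ‖w‖ = 1 ∧ u ≠ v ∧ v ≠ w ∧ u ≠ w ∧ F (e u) = y ∧ F (e v) = y ∧ F (e w) = y}.Nonempty → ∃ F' : S.carrier → EuclideanSpace ℝ (Fin 4), (∀ x, x ∉ e '' Metric.ball (0 : EuclideanSpace ℝ (Fin 4)) 1 → IsLocalDiffeomorphAt (𝓡 4) (𝓡 4) ∞ F' x) ∧ {y : EuclideanSpace ℝ (Fin 4) | ∃ a b c d : EuclideanSpace ℝ (Fin 4), ‖a‖ = 1 ∧ ‖b‖ = 1 ∧ ‖c‖ = 1 ∧ ‖d‖ = 1 ∧ a ≠ b ∧ a ≠ c ∧ a ≠ d ∧ b ≠ c ∧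 b ≠ d ∧ c ≠ d ∧ F' (e a) = y ∧ F' (e b) = y ∧ F' (e c) = y ∧ F' (e d) = y} = ∅ ∧ ((fun y => connectedComponentIn {y : EuclideanSpace ℝ (Fin 4) | ∃ u v w : EuclideanSpace ℝ (Fin 4), ‖u‖ = 1 ∧ ‖v‖ = 1 ∧ ‖w‖ = 1 ∧ u ≠ v ∧ v ≠ w ∧ u ≠ w ∧ F' (e u) = y ∧ F' (e v) = y ∧ F' (e w) = y} y) '' {y : EuclideanSpace ℝ (Fin 4) | ∃ u v w : EuclideanSpace ℝ (Fin 4), ‖u‖ = 1 ∧ ‖v‖ = 1 ∧ ‖w‖ = 1 ∧ u ≠ v ∧ v ≠ w ∧ u ≠ w ∧ F' (e u) = y ∧ F' (e v) = y ∧ F' (e w) = y}).Finite ∧ ((fun y => connectedComponentIn {y : EuclideanSpace ℝ (Fin 4) | ∃ u v w : EuclideanSpace ℝ (Fin 4), ‖u‖ = 1 ∧ ‖v‖ = 1 ∧ ‖w‖ = 1 ∧ u ≠ v ∧ v ≠ w ∧ u ≠ w ∧ F' (e u) = y ∧ F' (e v) = y ∧ F' (e w) = y} y) '' {y : EuclideanSpace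 ℝ (Fin 4) | ∃ u v w : EuclideanSpace ℝ (Fin 4), ‖u‖ = 1 ∧ ‖v‖ = 1 ∧ ‖w‖ = 1 ∧ u ≠ v ∧ v ≠ w ∧ u ≠ w ∧ F' (e u) = y ∧ F' (e v) = y ∧ F' (e w) = y}).ncard < ((fun y => connectedComponentIn {y : EuclideanSpace ℝ (Fin 4) | ∃ u v w : EuclideanSpace ℝ (Fin 4), ‖u‖ = 1 ∧ ‖v‖ = 1 ∧ ‖w‖ = 1 ∧ u ≠ v ∧ v ≠ w ∧ u ≠ w ∧ F (e u) = y ∧ F (e v) = y ∧ F (e w) = y} y) '' {y : EuclideanSpace ℝ (Fin 4) | ∃ u v w : EuclideanSpace ℝ (Fin 4), ‖u‖ = 1 ∧ ‖v‖ = 1 ∧ ‖w‖ = 1 ∧ u ≠ v ∧ v ≠ w ∧ u ≠ w ∧ F (e u) = y ∧ F (e v) = y ∧ F (e w) = y}).ncard) →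
    (∀ (S : Literature.Topology.FourManifolds.HomotopySphere 4) (e : EuclideanSpace ℝ (Fin 4) → S.carrier), Manifold.IsSmoothEmbedding (𝓡 4) (𝓡 4) ∞ e → ∃ F : S.carrier → EuclideanSpace ℝ (Fin 4), (∀ x, x ∉ e '' Metric.ball (0 : EuclideanSpace ℝ (Fin 4)) 1 → IsLocalDiffeomorphAt (𝓡 4) (𝓡 4) ∞ F x) ∧ ∀ u v w : EuclideanSpace ℝ (Fin 4), ‖u‖ = 1 → ‖v‖ = 1 → ‖w‖ = 1 → F (e u) = F (e v) → F (e v) = F (e w) → u = v ∨ v = w ∨ u = w) := by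
  intro hT hQ hE S e he
  -- the four functionals of an immersed fake ball `F` (for the fixed chart `e`)
  let Imm : (S.carrier → EuclideanSpace ℝ (Fin 4)) → Prop := fun F =>
    ∀ x, x ∉ e '' Metric.ball (0 : EuclideanSpace ℝ (Fin 4)) 1 → IsLocalDiffeomorphAt (𝓡 4) (𝓡 4) ∞ F x
  let Q : (S.carrier → EuclideanSpace ℝ (Fin 4)) → Set (EuclideanSpace ℝ (Fin 4)) := fun F =>
    {y : EuclideanSpace ℝ (Fin 4) | ∃ a b c d : EuclideanSpace ℝ (Fin 4), ‖a‖ = 1 ∧ ‖b‖ = 1 ∧ ‖c‖ = 1 ∧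
      ‖d‖ = 1 ∧ a ≠ b ∧ a ≠ c ∧ a ≠ d ∧ b ≠ c ∧ b ≠ d ∧ c ≠ d ∧ F (e a) = y ∧ F (e b) = y ∧
      F (e c) = y ∧ F (e d) = y}
  let T : (S.carrier → EuclideanSpace ℝ (Fin 4)) → Set (EuclideanSpace ℝ (Fin 4)) := fun F =>
    {y : EuclideanSpace ℝ (Fin 4) | ∃ u v w : EuclideanSpace ℝ (Fin 4), ‖u‖ = 1 ∧ ‖v‖ = 1 ∧ ‖w‖ = 1 ∧
      u ≠ v ∧ v ≠ w ∧ u ≠ w ∧ F (e u) = y ∧ F (e v) = y ∧ F (e w) = y}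
  let K : (S.carrier → EuclideanSpace ℝ (Fin 4)) → Set (Set (EuclideanSpace ℝ (Fin 4))) := fun F =>
    (fun y => connectedComponentIn (T F) y) '' (T F)
  -- the three pieces, specialised to `(S, e)`
  have hT' : ∃ F, Imm F ∧ (Q F).Finite ∧ (K F).Finite := hT S e he
  have hQ' : ∀ F, Imm F → (Q F).Finite → (Q F).Nonempty → (K F).Finite →
      ∃ F', Imm F' ∧ (Q F').Finite ∧ (Q F').ncard < (Q F).ncard ∧ (K F').Finite :=
    fun F => hQ S e F he
  have hE' : ∀ F, Imm F → Q F = ∅ → (K F).Finite → (T F).Nonempty →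
      ∃ F', Imm F' ∧ Q F' = ∅ ∧ (K F').Finite ∧ (K F').ncard < (K F).ncard :=
    fun F => hE S e F he
  -- rung 4 → 3: well-founded descent on the number of quadruple values
  have stage₁ : ∃ F, Imm F ∧ Q F = ∅ ∧ (K F).Finite := by
    obtain ⟨F₀, h₀, hq₀, hk₀⟩ := hT'
    suffices H : ∀ (n : ℕ) (F : S.carrier → EuclideanSpace ℝ (Fin 4)), Imm F → (Q F).Finite →
        (K F).Finite → (Q F).ncard = n → ∃ F', Imm F' ∧ Q F' = ∅ ∧ (K F').Finite from
      H _ F₀ h₀ hq₀ hk₀ rfl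
    intro n
    induction n using Nat.strong_induction_on with
    | _ n ih =>
      intro F hF hq hk hn
      rcases (Q F).eq_empty_or_nonempty with hQe | hQne
      · exact ⟨F, hF, hQe, hk⟩
      · obtain ⟨F', hF', hq', hlt, hk'⟩ := hQ' F hF hq hQne hk
        exact ih _ (hn ▸ hlt) F' hF' hq' hk' rfl
  -- rung 3 → 2: well-founded descent on the number of triple-value components
  have stage₂ : ∃ F, Imm F ∧ T F = ∅ := by
    obtain ⟨F₀, h₀, hq₀, hk₀⟩ := stage₁
    suffices H : ∀ (n : ℕ) (F : S.carrier → EuclideanSpace ℝ (Fin 4)), Imm F → Q F = ∅ →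
        (K F).Finite → (K F).ncard = n → ∃ F', Imm F' ∧ T F' = ∅ from H _ F₀ h₀ hq₀ hk₀ rfl
    intro n
    induction n using Nat.strong_induction_on with
    | _ n ih =>
      intro F hF hq hk hn
      rcases (T F).eq_empty_or_nonempty with hTe | hTne
      · exact ⟨F, hF, hTe⟩
      · obtain ⟨F', hF', hq', hk', hlt⟩ := hE' F hF hq hk hTne
        exact ih _ (hn ▸ hlt) F' hF' hq' hk' rfl
  -- an empty triple-value set is the "no triple points" clause of `CreaseCollapse`
  obtain ⟨F, hF, hTF⟩ := stage₂
  refine ⟨F, hF, ?_⟩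
  intro u v w hu hv hw h₁ h₂
  by_contra hne
  push Not at hne
  have hmem : F (e u) ∈ T F :=
    ⟨u, v, w, hu, hv, hw, hne.1, hne.2.1, hne.2.2, rfl, h₁.symm, (h₁.trans h₂).symm⟩
  rw [hTF] at hmem
  exact hmem


/-! ## 2. By name, and the GlueBy rehearsal -/

/-- **Crease ladder, by name**: the three children imply the ROUTE DECL `EuclideanOrigami.CreaseCollapse`
(δ-unfolding of the frame form; term mode). -/
theorem creaseCollapse_of_pieces_byName (h₁ : TameCrease) (h₂ : QuadrupleCancellation)
    (h₃ : TripleCircleElimination) : CreaseCollapse :=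
  creaseCollapse_of_pieces_frame h₁ h₂ h₃

namespace GlueByRehearsal

/-- Rehearsal of the gate-rendered link
`theorem CreaseCollapseGlueBy_holds : TameCrease → QuadrupleCancellation → TripleCircleElimination →
CreaseCollapse := _root_.<glue_by>` (children = the defs above, parent = the route decl). -/
theorem CreaseCollapseGlueBy_holds : TameCrease → QuadrupleCancellation → TripleCircleElimination → CreaseCollapse :=
  _root_.Summit.SmoothPoincare4.SmoothPoincare4.Cruxes.CreaseCollapse.LadderSeam.creaseCollapse_of_pieces_frame

/-- Rehearsal of the `--glue` variant: the generated glue ITEM would read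
`def CreaseLadderGlue : Prop := TameCrease → QuadrupleCancellation → TripleCircleElimination → CreaseCollapse`
and is closed by the same term after `unfold`. -/
def CreaseLadderGlue : Prop :=
  TameCrease → QuadrupleCancellation → TripleCircleElimination → CreaseCollapse

theorem creaseLadderGlue : CreaseLadderGlue := by
  unfold CreaseLadderGlue
  exact _root_.Summit.SmoothPoincare4.SmoothPoincare4.Cruxes.CreaseCollapse.LadderSeam.creaseCollapse_of_pieces_frame

end GlueByRehearsal

/-! ## 3. Positioning: every piece is a consequence of the crux -/

section Positioning

variable {S : Literature.Topology.FourManifolds.HomotopySphere 4}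

/-- A triple-point-free immersed fake ball has empty triple-value, quadruple-value and component sets. -/
theorem empty_of_noTriplePoints {e : EuclideanSpace ℝ (Fin 4) → S.carrier}
    {F : S.carrier → EuclideanSpace ℝ (Fin 4)} (h : NoTriplePoints e F) :
    tripleValues e F = ∅ ∧ quadValues e F = ∅ ∧ components (tripleValues e F) = ∅ := by
  have hT : tripleValues e F = ∅ := (noTriplePoints_iff_tripleValues_eq_empty e F).mp h
  refine ⟨hT, ?_, ?_⟩
  · exact subset_eq_empty (quadValues_subset_tripleValues e F) hT
  · simp [components, hT]

end Positioning

/-- The crux gives, at every `(S, e)`, an immersed fake ball with NO triple points — in the named form. -/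
theorem exists_noTriplePoints_of_creaseCollapse (h : CreaseCollapse)
    (S : Literature.Topology.FourManifolds.HomotopySphere 4) (e : EuclideanSpace ℝ (Fin 4) → S.carrier)
    (he : Manifold.IsSmoothEmbedding (𝓡 4) (𝓡 4) ∞ e) :
    ∃ F : S.carrier → EuclideanSpace ℝ (Fin 4), IsImmersedFakeBall e F ∧ NoTriplePoints e F :=
  h S e he

/-- POSITIONING 1: `CreaseCollapse → TameCrease`. -/
theorem tameCrease_of_creaseCollapse (h : CreaseCollapse) : TameCrease := by
  intro S e he
  obtain ⟨F, hF, hnt⟩ := exists_noTriplePoints_of_creaseCollapse h S e he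
  obtain ⟨hT, hQ, hK⟩ := empty_of_noTriplePoints hnt
  refine ⟨F, hF, ?_, ?_⟩
  · change (quadValues e F).Finite
    rw [hQ]; exact finite_empty
  · change (components (tripleValues e F)).Finite
    rw [hK]; exact finite_empty

/-- POSITIONING 2: `CreaseCollapse → QuadrupleCancellation` (answer every instance with the triple-point-free
immersed fake ball: it has `0 <` the given positive number of quadruple values). -/
theorem quadrupleCancellation_of_creaseCollapse (h : CreaseCollapse) : QuadrupleCancellation := by
  intro S e F he _hF hqf hqne _hk
  change (quadValues e F).Finite at hqf
  change (quadValues e F).Nonempty at hqne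
  obtain ⟨F', hF', hnt⟩ := exists_noTriplePoints_of_creaseCollapse h S e he
  obtain ⟨hT, hQ, hK⟩ := empty_of_noTriplePoints hnt
  refine ⟨F', hF', ?_, ?_, ?_⟩
  · change (quadValues e F').Finite
    rw [hQ]; exact finite_empty
  · change (quadValues e F').ncard < (quadValues e F).ncard
    rw [hQ, ncard_empty]
    exact (ncard_pos hqf).mpr hqne
  · change (components (tripleValues e F')).Finite
    rw [hK]; exact finite_empty

/-- POSITIONING 3: `CreaseCollapse → TripleCircleElimination`. -/
theorem tripleCircleElimination_of_creaseCollapse (h : CreaseCollapse) : TripleCircleElimination := by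
  intro S e F he _hF _hq hk hne
  change (components (tripleValues e F)).Finite at hk
  change (tripleValues e F).Nonempty at hne
  obtain ⟨F', hF', hnt⟩ := exists_noTriplePoints_of_creaseCollapse h S e he
  obtain ⟨hT, hQ, hK⟩ := empty_of_noTriplePoints hnt
  have hkne : (components (tripleValues e F)).Nonempty := by
    obtain ⟨y, hy⟩ := hne
    exact ⟨_, y, hy, rfl⟩
  refine ⟨F', hF', hQ, ?_, ?_⟩
  · change (components (tripleValues e F')).Finite
    rw [hK]; exact finite_empty
  · change (components (tripleValues e F')).ncard < (components (tripleValues e F)).ncard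
    rw [hK, ncard_empty]
    exact (ncard_pos hk).mpr hkne

/-- The conjunction of the three children is EQUIVALENT to the crux (no slack is lost or added in total;
the content sits in how the ladder distributes it over the rungs). -/
theorem creaseCollapse_iff_pieces :
    CreaseCollapse ↔ TameCrease ∧ QuadrupleCancellation ∧ TripleCircleElimination :=
  ⟨fun h => ⟨tameCrease_of_creaseCollapse h, quadrupleCancellation_of_creaseCollapse h,
    tripleCircleElimination_of_creaseCollapse h⟩,
    fun h => creaseCollapse_of_pieces_byName h.1 h.2.1 h.2.2⟩

/-! ## 4. Logical shape: the pieces are the rung implications of the ladder -/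

theorem tameCrease_iff :
    TameCrease ↔ ∀ (S : Literature.Topology.FourManifolds.HomotopySphere 4)
      (e : EuclideanSpace ℝ (Fin 4) → S.carrier), Manifold.IsSmoothEmbedding (𝓡 4) (𝓡 4) ∞ e → RungFour S e :=
  Iff.rfl

/-- `QuadrupleCancellation` ↔ (rung 4 → rung 3 at every `(S, e)`): "→" is the well-founded descent on the
number of quadruple values, "←" answers an instance with the quadruple-free witness. -/
theorem quadrupleCancellation_iff :
    QuadrupleCancellation ↔ ∀ (S : Literature.Topology.FourManifolds.HomotopySphere 4)
      (e : EuclideanSpace ℝ (Fin 4) → S.carrier), Manifold.IsSmoothEmbedding (𝓡 4) (𝓡 4) ∞ e →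
      RungFour S e → RungThree S e := by
  constructor
  · intro hQ S e he ⟨F₀, h₀, hq₀, hk₀⟩
    have hQ' : ∀ F, IsImmersedFakeBall e F → (quadValues e F).Finite → (quadValues e F).Nonempty →
        (components (tripleValues e F)).Finite → ∃ F', IsImmersedFakeBall e F' ∧ (quadValues e F').Finite ∧
          (quadValues e F').ncard < (quadValues e F).ncard ∧ (components (tripleValues e F')).Finite :=
      fun F => hQ S e F he
    suffices H : ∀ (n : ℕ) (F : S.carrier → EuclideanSpace ℝ (Fin 4)), IsImmersedFakeBall e F →
        (quadValues e F).Finite → (components (tripleValues e F)).Finite → (quadValues e F).ncard = n →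
        RungThree S e from H _ F₀ h₀ hq₀ hk₀ rfl
    intro n
    induction n using Nat.strong_induction_on with
    | _ n ih =>
      intro F hF hq hk hn
      rcases (quadValues e F).eq_empty_or_nonempty with hQe | hQne
      · exact ⟨F, hF, hQe, hk⟩
      · obtain ⟨F', hF', hq', hlt, hk'⟩ := hQ' F hF hq hQne hk
        exact ih _ (hn ▸ hlt) F' hF' hq' hk' rfl
  · intro h S e F he hF hqf hqne hk
    change (quadValues e F).Finite at hqf
    change (quadValues e F).Nonempty at hqne
    obtain ⟨F', hF', hq', hk'⟩ := h S e he ⟨F, hF, hqf, hk⟩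
    refine ⟨F', hF', ?_, ?_, hk'⟩
    · change (quadValues e F').Finite
      rw [hq']; exact finite_empty
    · change (quadValues e F').ncard < (quadValues e F).ncard
      rw [hq', ncard_empty]
      exact (ncard_pos hqf).mpr hqne

/-- `TripleCircleElimination` ↔ (rung 3 → rung 2 at every `(S, e)`): "→" is the well-founded descent on the
number of triple-value components, "←" answers an instance with the triple-point-free witness. -/
theorem tripleCircleElimination_iff :
    TripleCircleElimination ↔ ∀ (S : Literature.Topology.FourManifolds.HomotopySphere 4)
      (e : EuclideanSpace ℝ (Fin 4) → S.carrier), Manifold.IsSmoothEmbedding (𝓡 4) (𝓡 4) ∞ e →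
      RungThree S e → RungTwo S e := by
  constructor
  · intro hE S e he ⟨F₀, h₀, hq₀, hk₀⟩
    have hE' : ∀ F, IsImmersedFakeBall e F → quadValues e F = ∅ → (components (tripleValues e F)).Finite →
        (tripleValues e F).Nonempty → ∃ F', IsImmersedFakeBall e F' ∧ quadValues e F' = ∅ ∧
          (components (tripleValues e F')).Finite ∧
          (components (tripleValues e F')).ncard < (components (tripleValues e F)).ncard :=
      fun F => hE S e F he
    suffices H : ∀ (n : ℕ) (F : S.carrier → EuclideanSpace ℝ (Fin 4)), IsImmersedFakeBall e F →
        quadValues e F = ∅ → (components (tripleValues e F)).Finite →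
        (components (tripleValues e F)).ncard = n → RungTwo S e from H _ F₀ h₀ hq₀ hk₀ rfl
    intro n
    induction n using Nat.strong_induction_on with
    | _ n ih =>
      intro F hF hq hk hn
      rcases (tripleValues e F).eq_empty_or_nonempty with hTe | hTne
      · exact ⟨F, hF, hTe⟩
      · obtain ⟨F', hF', hq', hk', hlt⟩ := hE' F hF hq hk hTne
        exact ih _ (hn ▸ hlt) F' hF' hq' hk' rfl
  · intro h S e F he hF hq hk hne
    change (components (tripleValues e F)).Finite at hk
    change (tripleValues e F).Nonempty at hne
    obtain ⟨F', hF', hT'⟩ := h S e he ⟨F, hF, hq, hk⟩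
    have hkne : (components (tripleValues e F)).Nonempty := by
      obtain ⟨y, hy⟩ := hne
      exact ⟨_, y, hy, rfl⟩
    refine ⟨F', hF', ?_, ?_, ?_⟩
    · exact subset_eq_empty (quadValues_subset_tripleValues e F') hT'
    · change (components (tripleValues e F')).Finite
      simp [components, hT']
    · change (components (tripleValues e F')).ncard < (components (tripleValues e F)).ncard
      have hK' : components (tripleValues e F') = ∅ := by simp [components, hT']
      rw [hK', ncard_empty]
      exact (ncard_pos hk).mpr hkne

/-- The crux at `(S, e)` is RUNG 2 (for the record; both directions definitional up to
`noTriplePoints_iff_tripleValues_eq_empty`). -/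
theorem creaseCollapse_iff_rungTwo :
    CreaseCollapse ↔ ∀ (S : Literature.Topology.FourManifolds.HomotopySphere 4)
      (e : EuclideanSpace ℝ (Fin 4) → S.carrier), Manifold.IsSmoothEmbedding (𝓡 4) (𝓡 4) ∞ e → RungTwo S e := by
  constructor
  · intro h S e he
    exact (rungTwo_iff S e).mpr (h S e he)
  · intro h S e he
    exact (rungTwo_iff S e).mp (h S e he)

end Summit.SmoothPoincare4.SmoothPoincare4.Cruxes.CreaseCollapse.LadderSeam
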